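import Mathlib
import Summits.ValiantsHypothesis.ValiantsHypothesis.Theses.BarrierLever
import Summits.ValiantsHypothesis.ValiantsHypothesis.Theorems.BarrierLeverLevelCollapse
import Summits.ValiantsHypothesis.ValiantsHypothesis.Theorems.BarrierLeverDefinableEquationsStatus

/-!
# Crux `BarrierLever.DefinableEquations` (stmt-ValiantsHypothesis-8745) — the DUAL weakening: the
# lever also runs on `SHS_io ∧ DefEq` (lead c5)

Companion to `…InfinitelyOften.lean` (`SHS ∧ DefEq_io → VH`).  The assembly needs the hitting `n`
and the equation `n` to coincide ONCE beyond the level-collapse threshold, so EITHER crux may be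
weakened to "infinitely often in `n`" — but not both:

* `valiantsHypothesis_of_succinct_io_of_definableEquations` (registered sub-goal): if FSV Question 6
  holds infinitely often (`SHS_io`: for every level `a'` some `b` makes `SmallCircuits ℂ n b` hit the
  level-`a'` distinguishers for infinitely many `n`) and the crux `DefinableEquations` holds as filed
  (for all large `n`), then `VP_ℂ ≠ VNP_ℂ`;
* lead c4's `Status.isSuccinctHittingSet_io_of_not_definableEquations`: `¬ DefinableEquations → SHS_io`,
  so `DefinableEquations ∨ SHS_io` unconditionally (`definableEquations_or_succinct_io`), dual to
  `InfinitelyOften.succinct_or_io` (`SHS ∨ DefEq_io`);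
* `valiantsHypothesis_of_imp_dual`: hence `(DefinableEquations → SHS_io) → DefinableEquations → VH`:
  with the crux as filed, the OTHER crux is needed only in its infinitely-often form, which is free
  in the world where this crux fails.

So the route's open content can be presented as either pair {`SHS`, `SHS → DefEq_io`} or
{`DefEq`, `DefEq → SHS_io`}; in both presentations the implication is equivalent to its conclusion.
Pure logic over the tree's definitions; no definitions, no facts.
-/

set_option linter.dupNamespace false

noncomputable section

namespace Summit.ValiantsHypothesis.ValiantsHypothesis.Theorems.BarrierLeverDefinableEquations

open MvPolynomial
open Literature.Computability.AlgebraicComplexity Literature.Barriers.ValiantsHypothesis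
open Summit.ValiantsHypothesis.ValiantsHypothesis.Theses.BarrierLever
open scoped BigOperators

namespace InfinitelyOften

/-- **The lever on `SHS_io ∧ DefEq`.**  Under `VP = VNP`, `levelCollapse_proof` gives `a', n₁`;
the crux at the `b` supplied by `SHS_io a'` gives equations for all `n ≥ n₀'`; `SHS_io` at threshold
`n₀' + n₁` gives one `n` where the equation is a hit distinguisher — contradiction. [folklore] -/
theorem valiantsHypothesis_of_succinct_io_of_definableEquations
    (hSio : ∀ a : ℕ, ∃ b : ℕ, ∀ n₀ : ℕ, ∃ n : ℕ, n₀ ≤ n ∧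
      IsSuccinctHittingSet (degLEMonomials n) (SmallCircuits ℂ n b) (Distinguishers ℂ n a))
    (hD : DefinableEquations) : _root_.ValiantsHypothesis := by
  classical
  refine Classical.byContradiction fun hV => ?_
  obtain ⟨a, ha⟩ := hD
  obtain ⟨a', n₁, hcol⟩ := Summit.ValiantsHypothesis.Theorems.levelCollapse_proof hV a
  obtain ⟨b, hb⟩ := hSio a'
  obtain ⟨n₀', hdef⟩ := ha b
  obtain ⟨n, hn, hhit⟩ := hb (n₀' + n₁)
  obtain ⟨q, hq, H, hHc, hHd, hne, hvan⟩ := hdef n (by omega)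
  obtain ⟨f, hf, hfne⟩ := hhit _ (hcol n (by omega) q hq H hHc hHd) hne
  exact hfne (hvan f hf)

/-- **Unconditional dichotomy, dual form**: the crux as filed holds, or FSV Question 6 holds
infinitely often at every level. [folklore] -/
theorem definableEquations_or_succinct_io :
    DefinableEquations ∨
      ∀ a : ℕ, ∃ b : ℕ, ∀ n₀ : ℕ, ∃ n : ℕ, n₀ ≤ n ∧
        IsSuccinctHittingSet (degLEMonomials n) (SmallCircuits ℂ n b) (Distinguishers ℂ n a) := by
  by_cases h : DefinableEquations
  · exact Or.inl h
  · exact Or.inr (Status.isSuccinctHittingSet_io_of_not_definableEquations h)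

/-- **Dual presentation of the route's open load**: with the crux as filed, the other crux is needed
only infinitely often, and that form is free when this crux fails:
`(DefinableEquations → SHS_io) → DefinableEquations → VP_ℂ ≠ VNP_ℂ`. [folklore] -/
theorem valiantsHypothesis_of_imp_dual
    (himp : DefinableEquations → ∀ a : ℕ, ∃ b : ℕ, ∀ n₀ : ℕ, ∃ n : ℕ, n₀ ≤ n ∧
      IsSuccinctHittingSet (degLEMonomials n) (SmallCircuits ℂ n b) (Distinguishers ℂ n a))
    (hD : DefinableEquations) : _root_.ValiantsHypothesis :=
  valiantsHypothesis_of_succinct_io_of_definableEquations (himp hD) hD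

/-- The implication `DefinableEquations → SHS_io` is equivalent to `SHS_io` itself (the
`¬ DefinableEquations` world is settled by `Status.isSuccinctHittingSet_io_of_not_definableEquations`).
[folklore] -/
theorem imp_iff_succinct_io :
    (DefinableEquations → ∀ a : ℕ, ∃ b : ℕ, ∀ n₀ : ℕ, ∃ n : ℕ, n₀ ≤ n ∧
      IsSuccinctHittingSet (degLEMonomials n) (SmallCircuits ℂ n b) (Distinguishers ℂ n a)) ↔
    ∀ a : ℕ, ∃ b : ℕ, ∀ n₀ : ℕ, ∃ n : ℕ, n₀ ≤ n ∧
      IsSuccinctHittingSet (degLEMonomials n) (SmallCircuits ℂ n b) (Distinguishers ℂ n a) := by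
  constructor
  · intro h
    by_cases hD : DefinableEquations
    · exact h hD
    · exact Status.isSuccinctHittingSet_io_of_not_definableEquations hD
  · exact fun h _ => h

/-- FSV Question 6 as filed (`SuccinctHittingSetsForVP`, for all large `n`) implies its
infinitely-often form. [folklore] -/
theorem succinct_io_of_succinct
    (h : Summit.ValiantsHypothesis.ValiantsHypothesis.Theses.BarrierLever.SuccinctHittingSetsForVP) :
    ∀ a : ℕ, ∃ b : ℕ, ∀ n₀ : ℕ, ∃ n : ℕ, n₀ ≤ n ∧
      IsSuccinctHittingSet (degLEMonomials n) (SmallCircuits ℂ n b) (Distinguishers ℂ n a) := by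
  intro a
  obtain ⟨b, n₀', hb⟩ := h a
  exact ⟨b, fun n₀ => ⟨max n₀ n₀', le_max_left _ _, hb _ (le_max_right _ _)⟩⟩

end InfinitelyOften

/-- **Registered sub-goal `valiantsHypothesis_of_succinct_io_of_definableEquations` (verbatim
signature).**  The lever on the dual weakening: FSV Question 6 infinitely often plus the crux as
filed give `VP_ℂ ≠ VNP_ℂ` (`InfinitelyOften.valiantsHypothesis_of_succinct_io_of_definableEquations`).
[folklore] -/
theorem valiantsHypothesis_of_succinct_io_of_definableEquations :
    (∀ a : ℕ, ∃ b : ℕ, ∀ n₀ : ℕ, ∃ n : ℕ, n₀ ≤ n ∧ Literature.Barriers.ValiantsHypothesis.IsSuccinctHittingSet (Literature.Barriers.ValiantsHypothesis.degLEMonomials n) (Literature.Barriers.ValiantsHypothesis.SmallCircuits ℂ n b) (Literature.Barriers.ValiantsHypothesis.Distinguishers ℂ n a)) → Summit.ValiantsHypothesis.ValiantsHypothesis.Theses.BarrierLever.DefinableEquations → ValiantsHypothesis :=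
  fun hSio hD => InfinitelyOften.valiantsHypothesis_of_succinct_io_of_definableEquations hSio hD

end Summit.ValiantsHypothesis.ValiantsHypothesis.Theorems.BarrierLeverDefinableEquations

end
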